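/-
Copyright (c) 2026. All rights reserved.
Released under Apache 2.0 license as described in the file LICENSE.
Authors: abc-iut cell, wave-5 seat abc-iut-w5-d141 (L3 sub-DAG [SemiAnbd] Thm 5.4, row T54-7).
-/
import Mathlib.Topology.Algebra.Group.Basic
import Literature.AnabelianGeometry.SemiGraphs.ArithmeticCoverings
import HarnessLib

/-!
# [SemiAnbd] Theorem 5.4 (iii), clause 3 (surjectivity): the arithmetic translation of Corollary 3.9 (b)
# (sub-DAG SemiAnbd-Thm54, row T54-7; proof-only over the data of `ArithMaximalCompact.lean`)

Mochizuki, *Semi-graphs of anabelioids*, Publ. RIMS **42** (2006), §5, Theorem 5.4 (iii), author's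
manuscript p. 66 [cite: MochizukiSemiAnbd2006, Thm 5.4 (iii), p. 66]: "Applying `B^temp(−)` determines a
natural bijective correspondence between locally open morphisms of arithmetic semi-graphs of anabelioids
`𝔊 → ℍ` over `A` and arithmetically quasi-geometric morphisms of temperoids `B^temp(𝔊) → B^temp(ℍ)` over
`A^⊤`"; printed proof (p. 66): "Modulo the evident 'arithmetic translation' — e.g., 'nontrivial' is to be
replaced by 'arithmetically ample' and 'estranged' by 'arithmetically estranged' — the proofs are entirely
parallel to those of Theorem 3.7, Corollary 3.9."

This PROOF-ONLY file (no `def`, nothing asserted) KERNEL-CHECKS that arithmetic translation for the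
SURJECTIVITY clause (clause 3 of abc-iut-L3-t3's `ArithQuasiGeometricCorrespondenceStatement`,
`ArithmeticCoverings.lean`), i.e. it produces the coordinator's frozen binder `h3` of
`arithQuasiGeometricCorrespondenceStatement_of_rows` (abc-iut-w4-d085, `ArithThm54iiiAssembly.lean`) from
GEOMETRIC inputs only.  Over the data `D, D'` of p. 65 (`DecompositionData`) and augmentations
`augG : Π^temp_𝔊 → Π_A`, `augH' : Π^temp_ℍ → Π_A` (the coordinator's `e.symm.toMonoidHom.comp augH`; here any
homomorphism to `Π_A = π̂₁(A)` of `𝔊`):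

* STEP A (`geomShadowV/E_of_isArithQuasiGeometric`, proved): an arithmetically quasi-geometric
  `f : Π^temp_𝔊 → Π^temp_ℍ` maps the GEOMETRIC parts `Π^temp_{𝔊,v} ∩ Ker augG` (resp. `Π^temp_{𝔊,b} ∩ Ker augG`)
  onto open subgroups of the geometric parts of conjugates of `Π^temp_{ℍ,w}` (resp. `Π^temp_{ℍ,b'}`) — the
  arithmetic-to-geometric REDUCTION ("arithmetically ample" ↦ "nontrivial"), using Thm 5.4 (ii) on both sides
  (binders `hIIG`, `hIIH`, rows T54-3/T54-R) and `augH' ∘ f = augG`.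
* STEP B (input `hCor39`): the GEOMETRIC Corollary 3.9 (b) at the kernels — a continuous `f` over `A` whose
  restriction to `Ker augG = Π^temp_𝔾` is quasi-geometric in the sense of Step A is induced, up to an inner
  automorphism of `Π^temp_ℍ|_{geom} = Ker augH'`, by a morphism `g : 𝔾 → ℍ` of the geometric components
  (sub-DAG Cor39 rows R2′ + R3, abc-iut-w4-d083 / w4-d064 / w4-d080, transported by the producer T54-0 through
  the tempered chart; here a BINDER over the datum `ι : (𝔾 ⟶ ℍ) → (Ker augG →* Π^temp_ℍ)` =
  "`B^temp(g)` on the geometric tempered groups", Prop 3.6 (iv)).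
* STEP C (`geom_compat_of_over`, proved): Π_A-EQUIVARIANCE of that `g` — hence an arithmetic morphism
  `φ = (e, g) : 𝔊 → ℍ` OVER `A` (`ArithHom`, Def 5.1 (iv)) — from: `f` over `A`, the Prop 5.2 (iv) dictionary for
  `ι` (binders `hιG`, `hιH`: `B^temp` of an arithmetic twist `ρ_𝔾(a) ≫ g`, `g ≫ ρ_ℍ(e a)` is conjugation by
  lifts, up to geometric inner automorphisms) and INJECTIVITY of `g ↦ B^temp(g)` up to geometric inner
  automorphisms (binder `hιinj`, Cor 3.9 "bijective").
* STEP D (`kerAgree`, proved): `f` and `B^temp(φ)` (binder `btemp`, as in the coordinator's umbrella; tied to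
  `ι φ.geom` by the binder `hιbtemp`) agree on `Ker augG` up to a GEOMETRIC inner automorphism.
* STEP E (`eq_conj_of_kerAgree`, proved — the one NON-parallel step of the translation): two homomorphisms
  over `A` that agree on `Ker augG` agree everywhere, because their "difference cocycle" takes values in the
  centralizer in `Ker augH'` of an open subgroup of a geometric verticial subgroup, which is trivial
  (binder `hZ` = relative temp-slimness: Prop 5.2 (iii) temp-slimness of the verticial subgroups used
  relatively, together with the commensurator description of p. 65).
* ASSEMBLY (`Thm54iii.clause3_of_geometric`): the frozen binder `h3` of the umbrella, verbatim.

Every hypothesis is an INLINE shape over `(D, D', augG, augH')` or the data `ι`, `btemp` — never a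
`def … : Prop` fact (D-0067 (1)); each is a booked geometric row or a producer (T54-0/T54-B) debt, named in
its docstring.  Nothing here bears on [IUTchIII] Cor. 3.12; no side is taken; typed ≠ proved for the inputs.
-/

namespace Literature.AnabelianGeometry.SemiGraphs

open _root_.CategoryTheory

universe u v w uG uH uP uV uB uV' uB'

/-! ### Step A — arithmetic-to-geometric reduction (pure group theory over the data of p. 65) -/

section StepA

variable {Gtp : Type uG} [Group Gtp] [TopologicalSpace Gtp]
variable {Htp : Type uH} [Group Htp] [TopologicalSpace Htp]
variable {PA : Type uP} [Group PA] [TopologicalSpace PA]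
variable {V : Type uV} {B : Type uB} {V' : Type uV'} {B' : Type uB'}
variable {D : DecompositionData Gtp V B} {D' : DecompositionData Htp V' B'}
variable {augG : Gtp →* PA} {augH' : Htp →* PA} {f : Gtp →* Htp}

omit [TopologicalSpace Gtp] [TopologicalSpace Htp] [TopologicalSpace PA] in
/-- Over `A` (`augH' ∘ f = augG`), the image of a geometric part is the geometric part of the image:
`f(K ∩ Ker augG) = f(K) ∩ Ker augH'`. [cite: MochizukiSemiAnbd2006, Thm 5.4 (iii), p. 66] -/
theorem map_inf_ker_eq_of_over (hcomp : augH'.comp f = augG) (K : Subgroup Gtp) :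
    (K ⊓ augG.ker).map f = K.map f ⊓ augH'.ker := by
  apply le_antisymm
  · rintro _ ⟨k, hk, rfl⟩
    obtain ⟨hkK, hk⟩ := Subgroup.mem_inf.mp hk
    refine Subgroup.mem_inf.mpr ⟨⟨k, hkK, rfl⟩, ?_⟩
    have hk' : augG k = 1 := hk
    show augH' (f k) = 1
    rw [← MonoidHom.comp_apply, hcomp, hk']
  · intro y hy
    obtain ⟨hy₁, hy₂⟩ := Subgroup.mem_inf.mp hy
    obtain ⟨k, hkK, rfl⟩ := hy₁
    have hy' : augH' (f k) = 1 := hy₂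
    refine ⟨k, Subgroup.mem_inf.mpr ⟨hkK, ?_⟩, rfl⟩
    show augG k = 1
    rw [← hcomp, MonoidHom.comp_apply]
    exact hy'

omit [TopologicalSpace Gtp] [TopologicalSpace PA] in
/-- Restricting "maps onto an open subgroup" to the geometric parts: if `f` is over `A` and maps `K` onto an
open subgroup of `M`, it maps `K ∩ Ker augG` onto an open subgroup of `M ∩ Ker augH'`.
[cite: MochizukiSemiAnbd2006, Thm 5.4 (iii), p. 66] -/
theorem mapsOntoOpenSubgroupOf_inf_ker (hcomp : augH'.comp f = augG) {K : Subgroup Gtp}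
    {M : Subgroup Htp} (h : MapsOntoOpenSubgroupOf f K M) :
    MapsOntoOpenSubgroupOf f (K ⊓ augG.ker) (M ⊓ augH'.ker) := by
  refine ⟨?_, ?_⟩
  · rw [map_inf_ker_eq_of_over hcomp]
    exact inf_le_inf_right _ h.1
  · -- the inclusion `M ∩ Ker augH' ↪ M` is continuous and pulls back `f(K)` to `f(K ∩ Ker augG)`
    have hincl : Continuous (Subgroup.inclusion (inf_le_left : M ⊓ augH'.ker ≤ M)) :=
      continuous_induced_rng.2 continuous_subtype_val
    have hset : (Subtype.val : (M ⊓ augH'.ker : Subgroup Htp) → Htp) ⁻¹' ((K ⊓ augG.ker).map f : Set Htp) =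
        Subgroup.inclusion (inf_le_left : M ⊓ augH'.ker ≤ M) ⁻¹'
          ((Subtype.val : M → Htp) ⁻¹' (K.map f : Set Htp)) := by
      ext ⟨y, hyM, hyk⟩
      simp only [Set.mem_preimage, SetLike.mem_coe, Subgroup.coe_inclusion]
      rw [map_inf_ker_eq_of_over hcomp]
      exact ⟨fun hy => hy.1, fun hy => ⟨hy, hyk⟩⟩
    rw [hset]
    exact h.2.preimage hincl

/-- **Step A, vertices.** An arithmetically quasi-geometric `f` maps the geometric part of every verticial
representative `Π^temp_{𝔊,v}` onto an open subgroup of the geometric part of a conjugate of some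
`Π^temp_{ℍ,w}` (Thm 5.4 (ii) on both sides turns "arithmetically maximal compact" into "verticial").
[cite: MochizukiSemiAnbd2006, Thm 5.4 (iii), p. 66] -/
theorem geomShadowV_of_isArithQuasiGeometric (hIIG : ArithMaximalCompactStatementII D augG)
    (hIIH : ArithMaximalCompactStatementII D' augH') (hf : IsArithQuasiGeometric augG augH' f) (v : V) :
    ∃ (w : V') (x : Htp), MapsOntoOpenSubgroupOf f (D.vertGp v) (conjSubgroup x (D'.vertGp w)) ∧
      MapsOntoOpenSubgroupOf f (D.vertGp v ⊓ augG.ker) (conjSubgroup x (D'.vertGp w) ⊓ augH'.ker) := by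
  have hK₁ : IsArithMaximalCompact augG (D.vertGp v) := (hIIG.1 _).mpr ⟨v, 1, by
    ext y; simp [conjSubgroup]⟩
  obtain ⟨K₂, hK₂, hmap⟩ := hf.2.2.1 _ hK₁
  obtain ⟨w, x, rfl⟩ := (hIIH.1 K₂).mp hK₂
  exact ⟨w, x, hmap, mapsOntoOpenSubgroupOf_inf_ker hf.2.1 hmap⟩

/-- **Step A, branches.** An arithmetically quasi-geometric `f` maps the geometric part of every branch
representative `Π^temp_{𝔊,b}` (an edge-like subgroup = arithmetically ample intersection of two distinct
arithmetically maximal compact subgroups, Thm 5.4 (ii)) onto an open subgroup of the geometric part of a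
conjugate of some `Π^temp_{ℍ,b'}`. [cite: MochizukiSemiAnbd2006, Thm 5.4 (iii), p. 66] -/
theorem geomShadowE_of_isArithQuasiGeometric (hIIG : ArithMaximalCompactStatementII D augG)
    (hIIH : ArithMaximalCompactStatementII D' augH') (hf : IsArithQuasiGeometric augG augH' f) (b : B) :
    ∃ (b' : B') (x : Htp), MapsOntoOpenSubgroupOf f (D.brGp b) (conjSubgroup x (D'.brGp b')) ∧
      MapsOntoOpenSubgroupOf f (D.brGp b ⊓ augG.ker) (conjSubgroup x (D'.brGp b') ⊓ augH'.ker) := by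
  have hE : IsEdgeLike D (D.brGp b) := ⟨b, 1, by ext y; simp [conjSubgroup]⟩
  obtain ⟨hamp, M₁, M₂, hM₁, hM₂, hne, heq⟩ := (hIIG.2 _).mpr hE
  obtain ⟨K₂, H₂, hK₂, hH₂, hne', hamp', hmap⟩ := hf.2.2.2 M₁ M₂ hM₁ hM₂ hne (heq ▸ hamp)
  obtain ⟨b', x, hb'⟩ := (hIIH.2 (K₂ ⊓ H₂)).mp ⟨hamp', K₂, H₂, hK₂, hH₂, hne', rfl⟩
  rw [← heq] at hmap
  rw [hb'] at hmap
  exact ⟨b', x, hmap, mapsOntoOpenSubgroupOf_inf_ker hf.2.1 hmap⟩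

end StepA

/-! ### Step E — the extension step (relative temp-slimness): homomorphisms over `A` agreeing on `Ker augG` -/

section StepE

variable {Gtp : Type uG} [Group Gtp]
variable {Htp : Type uH} [Group Htp]
variable {PA : Type uP} [Group PA]
variable {augG : Gtp →* PA} {augH' : Htp →* PA} {f F : Gtp →* Htp}

/-- **The one non-parallel step of the arithmetic translation.** Two homomorphisms `f, F : Π^temp_𝔊 → Π^temp_ℍ`
over `A` (`augH' ∘ f = augG = augH' ∘ F`) that agree on `Ker augG` agree everywhere, PROVIDED the centraliser
in `Ker augH'` of the image `f(S)` of some subgroup `S ⊆ Ker augG` is trivial: the "difference cocycle"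
`γ ↦ F(γ)⁻¹ f(γ)` takes values in that centraliser. [cite: MochizukiSemiAnbd2006, Thm 5.4 (iii), p. 66] -/
theorem eq_of_kerAgree_of_centralizer (hcompf : augH'.comp f = augG) (hcompF : augH'.comp F = augG)
    (hagree : ∀ x ∈ augG.ker, f x = F x) (S : Subgroup Gtp) (hS : S ≤ augG.ker)
    (hZ : ∀ z ∈ augH'.ker, (∀ u ∈ S.map f, z * u = u * z) → z = 1) (γ : Gtp) : f γ = F γ := by
  have hz : (F γ)⁻¹ * f γ ∈ augH'.ker := by
    rw [MonoidHom.mem_ker, map_mul, map_inv, ← MonoidHom.comp_apply, ← MonoidHom.comp_apply, hcompf,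
      hcompF, inv_mul_cancel]
  have hcomm : ∀ u ∈ S.map f, (F γ)⁻¹ * f γ * u = u * ((F γ)⁻¹ * f γ) := by
    rintro _ ⟨s, hs, rfl⟩
    have hsk : γ * s * γ⁻¹ ∈ augG.ker := (MonoidHom.normal_ker augG).conj_mem s (hS hs) γ
    have h1 : f (γ * s * γ⁻¹) = F (γ * s * γ⁻¹) := hagree _ hsk
    rw [map_mul, map_mul, map_inv, map_mul, map_mul, map_inv, ← hagree s (hS hs)] at h1
    -- `f γ · f s · (f γ)⁻¹ = F γ · f s · (F γ)⁻¹`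
    have h2 : (F γ)⁻¹ * f γ * f s = f s * (F γ)⁻¹ * f γ := by
      calc (F γ)⁻¹ * f γ * f s = (F γ)⁻¹ * (f γ * f s * (f γ)⁻¹) * f γ := by group
        _ = (F γ)⁻¹ * (F γ * f s * (F γ)⁻¹) * f γ := by rw [h1]
        _ = f s * (F γ)⁻¹ * f γ := by group
    rw [h2, mul_assoc]
  have := hZ _ hz hcomm
  calc f γ = F γ * ((F γ)⁻¹ * f γ) := by group
    _ = F γ := by rw [this, mul_one]

end StepE

/-! ### Steps B–D and the assembly of clause 3 -/

section Main

variable {Obj : Type u} [Category.{v} Obj] {𝓥 : SemiAnbdVocab.{u, v, w} Obj}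
variable {𝔊 ℍ : ArithSemiGraph 𝓥} {e : 𝔊.PA ≃* ℍ.PA}
variable {Gtp : Type uG} [Group Gtp] [TopologicalSpace Gtp]
variable {Htp : Type uH} [Group Htp] [TopologicalSpace Htp]
variable {V : Type uV} {B : Type uB} {V' : Type uV'} {B' : Type uB'}
variable {D : DecompositionData Gtp V B} {D' : DecompositionData Htp V' B'}

omit [TopologicalSpace Gtp] [TopologicalSpace Htp] in
/-- **Step C — Π_A-equivariance of the geometric morphism** ([SemiAnbd] Thm 5.4 (iii) p. 66, the arithmetic
translation of Cor 3.9 (b): the morphism `g : 𝔾 → ℍ` inducing `f|_{Π^temp_𝔾}` up to a geometric inner automorphism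
commutes with the arithmetic actions through `e : π̂₁(A) = π̂₁(A)`, i.e. `(e, g)` is a morphism of ARITHMETIC
semi-graphs of anabelioids over `A`, Def 5.1 (iv)).  Inputs: `f` over `A` (`augH' ∘ f = augG`), a lift `γ` of
each `a ∈ π̂₁(A)` (surjectivity of `augG`, Prop 5.2 (iv)), the Prop 5.2 (iv) dictionary for
`ι = B^temp(−)|_{geom}` on arithmetic twists (`hιG`, `hιH`: conjugation by lifts, up to geometric inner
automorphisms) and injectivity of `ι` up to geometric inner automorphisms (`hιinj`, Cor 3.9 "bijective").
[cite: MochizukiSemiAnbd2006, Thm 5.4 (iii), p. 66] -/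
theorem geom_compat_of_over {augG : Gtp →* 𝔊.PA} {augH' : Htp →* 𝔊.PA}
    (ι : (𝔊.G ⟶ ℍ.G) → (augG.ker →* Htp))
    (hιG : ∀ (g : 𝔊.G ⟶ ℍ.G) (a : 𝔊.PA) (γ : Gtp), augG γ = a → ∃ δ ∈ augH'.ker,
      ∀ x : augG.ker, ι ((𝔊.ρ a).hom ≫ g) x =
        δ * ι g ⟨γ * x * γ⁻¹, (MonoidHom.normal_ker augG).conj_mem _ x.2 γ⟩ * δ⁻¹)
    (hιH : ∀ (g : 𝔊.G ⟶ ℍ.G) (a : 𝔊.PA) (η : Htp), augH' η = a → ∃ δ ∈ augH'.ker,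
      ∀ x : augG.ker, ι (g ≫ (ℍ.ρ (e a)).hom) x = δ * (η * ι g x * η⁻¹) * δ⁻¹)
    (hιinj : ∀ g₁ g₂ : 𝔊.G ⟶ ℍ.G,
      (∃ δ ∈ augH'.ker, ∀ x : augG.ker, ι g₁ x = δ * ι g₂ x * δ⁻¹) → g₁ = g₂)
    (hsurjG : Function.Surjective augG) {f : Gtp →* Htp} (hcomp : augH'.comp f = augG)
    {g : 𝔊.G ⟶ ℍ.G} {h : Htp} (hh : h ∈ augH'.ker) (hfg : ∀ x : augG.ker, f x = h * ι g x * h⁻¹)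
    (a : 𝔊.PA) : (𝔊.ρ a).hom ≫ g = g ≫ (ℍ.ρ (e a)).hom := by
  obtain ⟨γ, hγ⟩ := hsurjG a
  -- the lift `η := h⁻¹ · f γ · h` of `a` on the `ℍ`-side
  have hh1 : augH' h = 1 := hh
  have hη : augH' (h⁻¹ * f γ * h) = a := by
    rw [map_mul, map_mul, map_inv, hh1, inv_one, one_mul, mul_one, ← MonoidHom.comp_apply, hcomp, hγ]
  obtain ⟨δ₁, hδ₁, h1⟩ := hιH g a (h⁻¹ * f γ * h) hη
  obtain ⟨δ₂, hδ₂, h2⟩ := hιG g a γ hγ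
  -- `ι g (γ x γ⁻¹) = η · ι g x · η⁻¹`
  have hconj : ∀ x : augG.ker,
      ι g ⟨γ * x * γ⁻¹, (MonoidHom.normal_ker augG).conj_mem _ x.2 γ⟩ =
        (h⁻¹ * f γ * h) * ι g x * (h⁻¹ * f γ * h)⁻¹ := by
    intro x
    have hx := hfg ⟨γ * x * γ⁻¹, (MonoidHom.normal_ker augG).conj_mem _ x.2 γ⟩
    simp only [map_mul, map_inv] at hx
    -- `hx : f γ * f x * (f γ)⁻¹ = h * ι g ⟨γ x γ⁻¹⟩ * h⁻¹`
    have hx' := hfg x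
    calc ι g ⟨γ * x * γ⁻¹, (MonoidHom.normal_ker augG).conj_mem _ x.2 γ⟩
        = h⁻¹ * (h * ι g ⟨γ * x * γ⁻¹, (MonoidHom.normal_ker augG).conj_mem _ x.2 γ⟩ * h⁻¹) * h := by group
      _ = h⁻¹ * (f γ * f x * (f γ)⁻¹) * h := by rw [hx]
      _ = h⁻¹ * (f γ * (h * ι g x * h⁻¹) * (f γ)⁻¹) * h := by rw [hx']
      _ = (h⁻¹ * f γ * h) * ι g x * (h⁻¹ * f γ * h)⁻¹ := by group
  refine hιinj _ _ ⟨δ₂ * δ₁⁻¹, augH'.ker.mul_mem hδ₂ (augH'.ker.inv_mem hδ₁), fun x => ?_⟩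
  rw [h2 x, hconj x, h1 x]
  group

/-- **[SemiAnbd] Theorem 5.4 (iii), clause 3 (surjectivity), from geometric inputs** — the binder `h3` of
the coordinator's `arithQuasiGeometricCorrespondenceStatement_of_rows`, verbatim: every arithmetically
quasi-geometric continuous `f : Π^temp_𝔊 → Π^temp_ℍ` over `A` arises, up to an inner automorphism of `Π^temp_ℍ`,
from a locally open morphism `𝔊 → ℍ` over `A` ("the proofs are entirely parallel to those of Theorem 3.7,
Corollary 3.9", p. 66).  INPUTS (inline shapes; rows of sub-DAG SemiAnbd-Thm54 / SemiAnbd-Cor39 and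
producer debts T54-0/T54-B, nothing asserted): Thm 5.4 (ii) on both sides (`hIIG`, `hIIH`); the geometric
Cor 3.9 (b) at the kernels (`hCor39`: rows R2′ + R3 through the tempered chart) over the datum
`ι = B^temp(−)|_{geom}` with its Prop 5.2 (iv) dictionary (`hιG`, `hιH`), injectivity (`hιinj`) and its tie to
the arithmetic `B^temp` (`hιbtemp`); `B^temp(φ)` over `A` (`hover`, as in the umbrella); surjectivity of
`augG` (Prop 5.2 (iv)); continuity of `e`; a vertex of `𝔾`; and relative temp-slimness of the geometric
verticial subgroups of `Π^temp_ℍ` (`hZ`: trivial centraliser in `Ker augH'` of their open subgroups — Prop 5.2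
(iii) used relatively with the commensurator description of p. 65).  Route: Step A (reduction to the geometric
parts) → `hCor39` → Step C (equivariance ⇒ `φ := (e, g)` over `A`) → Step D (`f = B^temp(φ)` on `Ker augG` up to
a geometric inner automorphism, via `hιbtemp`) → Step E (`eq_of_kerAgree_of_centralizer`).
[cite: MochizukiSemiAnbd2006, Thm 5.4 (iii), p. 66] -/
theorem Thm54iii.clause3_of_geometric (augG : Gtp →* 𝔊.PA) (augH' : Htp →* 𝔊.PA)
    (btemp : (φ : ArithHom 𝓥 𝔊 ℍ) → φ.IsLocallyOpen → ArithHom.IsOverA 𝔊 ℍ e φ → (Gtp →* Htp))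
    (hIIG : ArithMaximalCompactStatementII D augG) (hIIH : ArithMaximalCompactStatementII D' augH')
    (hover : ∀ (φ : ArithHom 𝓥 𝔊 ℍ) (h₁ : φ.IsLocallyOpen) (h₂ : ArithHom.IsOverA 𝔊 ℍ e φ),
      augH'.comp (btemp φ h₁ h₂) = augG)
    (ι : (𝔊.G ⟶ ℍ.G) → (augG.ker →* Htp))
    (hιG : ∀ (g : 𝔊.G ⟶ ℍ.G) (a : 𝔊.PA) (γ : Gtp), augG γ = a → ∃ δ ∈ augH'.ker,
      ∀ x : augG.ker, ι ((𝔊.ρ a).hom ≫ g) x =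
        δ * ι g ⟨γ * x * γ⁻¹, (MonoidHom.normal_ker augG).conj_mem _ x.2 γ⟩ * δ⁻¹)
    (hιH : ∀ (g : 𝔊.G ⟶ ℍ.G) (a : 𝔊.PA) (η : Htp), augH' η = a → ∃ δ ∈ augH'.ker,
      ∀ x : augG.ker, ι (g ≫ (ℍ.ρ (e a)).hom) x = δ * (η * ι g x * η⁻¹) * δ⁻¹)
    (hιinj : ∀ g₁ g₂ : 𝔊.G ⟶ ℍ.G,
      (∃ δ ∈ augH'.ker, ∀ x : augG.ker, ι g₁ x = δ * ι g₂ x * δ⁻¹) → g₁ = g₂)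
    (hιbtemp : ∀ (φ : ArithHom 𝓥 𝔊 ℍ) (h₁ : φ.IsLocallyOpen) (h₂ : ArithHom.IsOverA 𝔊 ℍ e φ),
      ∃ δ ∈ augH'.ker, ∀ x : augG.ker, btemp φ h₁ h₂ x = δ * ι φ.geom x * δ⁻¹)
    (hCor39 : ∀ f : Gtp →* Htp, Continuous f → augH'.comp f = augG →
      (∀ v : V, ∃ (w : V') (x : Htp),
        MapsOntoOpenSubgroupOf f (D.vertGp v ⊓ augG.ker) (conjSubgroup x (D'.vertGp w) ⊓ augH'.ker)) →
      (∀ b : B, ∃ (b' : B') (x : Htp),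
        MapsOntoOpenSubgroupOf f (D.brGp b ⊓ augG.ker) (conjSubgroup x (D'.brGp b') ⊓ augH'.ker)) →
      ∃ (g : 𝔊.G ⟶ ℍ.G), ∃ h ∈ augH'.ker, ∀ x : augG.ker, f x = h * ι g x * h⁻¹)
    (hZ : ∀ (w : V') (x : Htp) (U : Subgroup Htp), U ≤ conjSubgroup x (D'.vertGp w) ⊓ augH'.ker →
      IsOpen ((Subtype.val : (conjSubgroup x (D'.vertGp w) ⊓ augH'.ker : Subgroup Htp) → Htp) ⁻¹'
        (U : Set Htp)) →
      ∀ z ∈ augH'.ker, (∀ u ∈ U, z * u = u * z) → z = 1)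
    (hsurjG : Function.Surjective augG) (he : Continuous e) (hV : Nonempty V) :
    ∀ f : Gtp →* Htp, IsArithQuasiGeometric augG augH' f →
      ∃ (φ : ArithHom 𝓥 𝔊 ℍ) (h₁ : φ.IsLocallyOpen) (h₂ : ArithHom.IsOverA 𝔊 ℍ e φ) (h : Htp),
        ∀ g, f g = h * btemp φ h₁ h₂ g * h⁻¹ := by
  intro f hf
  -- Step A + Step B: the geometric morphism
  obtain ⟨g, h, hh, hfg⟩ := hCor39 f hf.1 hf.2.1
    (fun v => by
      obtain ⟨w, x, -, hgeo⟩ := geomShadowV_of_isArithQuasiGeometric hIIG hIIH hf v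
      exact ⟨w, x, hgeo⟩)
    (fun b => by
      obtain ⟨b', x, -, hgeo⟩ := geomShadowE_of_isArithQuasiGeometric hIIG hIIH hf b
      exact ⟨b', x, hgeo⟩)
  -- Step C: equivariance, hence an arithmetic morphism `φ = (e, g)` over `A`
  have hcompat : ∀ a : 𝔊.PA, (𝔊.ρ a).hom ≫ g = g ≫ (ℍ.ρ (e.toMonoidHom a)).hom := fun a =>
    geom_compat_of_over ι hιG hιH hιinj hsurjG hf.2.1 hh hfg a
  let φ : ArithHom 𝓥 𝔊 ℍ :=
    { arith := e.toMonoidHom, continuous_arith := he, geom := g, compat := hcompat }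
  have h₁ : φ.IsLocallyOpen := by
    show IsOpen (Set.range (e.toMonoidHom : 𝔊.PA → ℍ.PA))
    have hr : Set.range (e.toMonoidHom : 𝔊.PA → ℍ.PA) = Set.univ := by
      rw [MulEquiv.coe_toMonoidHom]
      exact Set.range_eq_univ.mpr e.surjective
    rw [hr]
    exact isOpen_univ
  have h₂ : ArithHom.IsOverA 𝔊 ℍ e φ := fun a => rfl
  -- Step D: agreement on the kernel with a conjugate of `btemp φ`
  obtain ⟨δ, hδ, hbt⟩ := hιbtemp φ h₁ h₂
  have hk : h * δ⁻¹ ∈ augH'.ker := augH'.ker.mul_mem hh (augH'.ker.inv_mem hδ)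
  have hagree : ∀ x ∈ augG.ker,
      f x = (MulAut.conj (h * δ⁻¹)).toMonoidHom.comp (btemp φ h₁ h₂) x := by
    intro x hx
    have e1 := hfg ⟨x, hx⟩
    have e2 := hbt ⟨x, hx⟩
    change btemp φ h₁ h₂ x = δ * ι g ⟨x, hx⟩ * δ⁻¹ at e2
    change f x = h * ι g ⟨x, hx⟩ * h⁻¹ at e1
    change f x = (h * δ⁻¹) * btemp φ h₁ h₂ x * (h * δ⁻¹)⁻¹
    rw [e1, e2]
    group
  -- Step E: the two homomorphisms over `A` agree everywhere
  refine ⟨φ, h₁, h₂, h * δ⁻¹, fun γ => ?_⟩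
  obtain ⟨v₀⟩ := hV
  obtain ⟨w, x, -, hU⟩ := geomShadowV_of_isArithQuasiGeometric hIIG hIIH hf v₀
  have hF : augH'.comp ((MulAut.conj (h * δ⁻¹)).toMonoidHom.comp (btemp φ h₁ h₂)) = augG := by
    ext y
    have hk1 : augH' (h * δ⁻¹) = 1 := hk
    have hy := congrArg (fun ψ : Gtp →* 𝔊.PA => ψ y) (hover φ h₁ h₂)
    simp only [MonoidHom.comp_apply] at hy ⊢
    rw [MulEquiv.coe_toMonoidHom, MulAut.conj_apply, map_mul, map_mul, map_inv, hk1, hy, one_mul,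
      inv_one, mul_one]
  have key := eq_of_kerAgree_of_centralizer hf.2.1 hF hagree (D.vertGp v₀ ⊓ augG.ker) inf_le_right
    (hZ w x _ hU.1 hU.2) γ
  rw [key]
  rfl

end Main

end Literature.AnabelianGeometry.SemiGraphs
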